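import Mathlib.NumberTheory.PrimeCounting
import Mathlib.Analysis.Asymptotics.Defs
import Literature.NumberTheory.LFunctions.LogIntegral
import Literature.NumberTheory.LFunctions.RiemannXi
import Literature.NumberTheory.LFunctions.Equivalents
import Literature.NumberTheory.LFunctions.WeilExplicit
import Literature.NumberTheory.LFunctions.ZeroCounting
import Literature.NumberTheory.LFunctions.ZeroStatistics
import HarnessLib
import Summits.RiemannHypothesis.RiemannHypothesis.Theorems.WeilPositivity

/-!
# Named facts: classical equivalents and consequences of the Riemann hypothesis

Grounder file (D-0014 named facts) for the route `RiemannHypothesis/InterimAntSieve`. Each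
declaration below is a published theorem *about* Mathlib's `RiemannHypothesis` that the tree has
not proved; it is recorded as `def <name> : Prop := <statement as printed>` with its citation, so
that routes can take `(h : <name>)` as a hypothesis and a later `theorem <name>_holds : <name>`
discharges it. Nothing here is asserted.

These facts were split out of the interim `Statements/RH/{Equivalents,WeilCriterion,ZeroCounting,
ZeroStatistics}.lean` by the M5 migration (the corresponding Literature files keep the
definitions `logIntegral`, `keiperLiCoeff`, `JensenPolyaCriterion`, `WeilPositivity`,
`DensityHypothesis`, `montgomeryFormFactor`, `levelCorrelationSum`, …); they live in a separate
file because those files still carry migration-only `[cite pending]` tags.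

## Contents (statement item ↦ fact)

* `Literature.NumberTheory.LFunctions.von_koch` (rh.S20; stmt-RiemannHypothesis-0014): `RH ↔ π(x) = li(x) + O(√x log x)`.
* `Literature.NumberTheory.LFunctions.schoenfeld_explicit` (rh.S20; stmt-0015): `RH → |π(x) − li(x)| < √x log x/(8π)`, `x ≥ 2657`.
* `Literature.NumberTheory.LFunctions.li_criterion` (rh.S26; stmt-0016): `RH ↔ ∀ n ≥ 1, λ_n ≥ 0`.
* `Literature.NumberTheory.LFunctions.polya_jensen` (rh.S39; stmt-0017): `RH ↔ JensenPolyaCriterion`.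
* `Literature.NumberTheory.LFunctions.weil_criterion` (rh.S29; stmt-0018, and stmt-0019 via
  `uniformWeilPositivity_iff_weilPositivity`): `RH ↔ WeilPositivity`.
* `Literature.NumberTheory.LFunctions.densityHypothesis_of_riemannHypothesis` (rh.S13; stmt-0020): `RH → DensityHypothesis`.
* `Literature.NumberTheory.LFunctions.montgomery_pair_correlation_restricted`, `Literature.NumberTheory.LFunctions.tendsto_montgomeryFormFactor` (rh.S31;
  stmt-0021/0022): Montgomery's theorem on `F(α, T)` for `|α| < 1`.
* `Literature.NumberTheory.LFunctions.rudnick_sarnak` (rh.S32; stmt-0023): `n`-level correlations for restricted Fourier support.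

## References

* H. von Koch, *Sur la distribution des nombres premiers*, Acta Math. 24 (1901), 159–182.
* L. Schoenfeld, *Sharper bounds for the Chebyshev functions θ(x) and ψ(x). II*, Math. Comp. 30
  (1976), 337–360, Cor. 1, (6.18).
* X.-J. Li, *The positivity of a sequence of numbers and the Riemann hypothesis*, J. Number
  Theory 65 (1997), 325–333, Thm. 1; E. Bombieri, J. Lagarias, J. Number Theory 77 (1999), Cor. 1.
* G. Pólya, Kgl. Danske Vid. Sel. Math.-Fys. Medd. 7 (1927); M. Griffin, K. Ono, L. Rolen,
  D. Zagier, PNAS 116 (2019), §1.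
* A. Weil, Comm. Sém. Math. Univ. Lund (1952); E. Bombieri, *Remarks on Weil's quadratic
  functional in the theory of prime numbers I*, Rend. Mat. Acc. Lincei (9) 11 (2000), 183–233,
  Thms. 1–2; H. Yoshida, Adv. Stud. Pure Math. 21 (1992).
* H. Iwaniec, E. Kowalski, *Analytic Number Theory* (2004), §10.5.
* H. L. Montgomery, *The pair correlation of zeros of the zeta function*, Proc. Symp. Pure Math.
  24 (1973), 181–193, Theorem; D. Goldston, H. Montgomery (1987).
* Z. Rudnick, P. Sarnak, *Zeros of principal L-functions and random matrix theory*, Duke Math.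
  J. 81 (1996), 269–322, Thm. 1.2 (Thm. 1.1 is its smoothed, unconditional form); N. Katz,
  P. Sarnak, Bull. AMS 36 (1999), §1.
-/

noncomputable section

open Complex Filter Asymptotics Polynomial Set MeasureTheory
open scoped Real Topology

namespace Literature.NumberTheory.LFunctions

/-! ## rh.S20 — von Koch and Schoenfeld -/

/-- **rh.S20** NAMED FACT (von Koch's criterion; H. von Koch, *Sur la distribution des nombres
premiers*, Acta Math. 24 (1901), 159–182: RH implies `π(x) = li(x) + O(√x log x)`; the converse
— an error term `O(x^{1/2+ε})` forces `ζ(s) ≠ 0` for `Re s > 1/2` by Mellin inversion /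
Landau's theorem — is classical, e.g. Davenport, *Multiplicative Number Theory*, ch. 18, or
Montgomery–Vaughan, *Multiplicative Number Theory I*, Thm. 13.1 with Thm. 15.3).
The Riemann hypothesis holds if and only if `π(x) = li(x) + O(√x log x)` as `x → ∞`.
Here `π(x) = Nat.primeCounting ⌊x⌋₊` and `li = logIntegral` (principal value from `0`;
replacing `li` by `Li = li − li 2` changes the left side by a constant, immaterial against
`√x log x`). Users take `(h : von_koch)`. [cite: Koch1901, Acta Math. 24, main theorem] -/
def von_koch : Prop :=
  RiemannHypothesis ↔
    (fun x : ℝ ↦ (Nat.primeCounting ⌊x⌋₊ : ℝ) - logIntegral x) =O[atTop]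
      fun x ↦ Real.sqrt x * Real.log x

/-- **rh.S20** NAMED FACT (Schoenfeld's explicit von Koch bound; L. Schoenfeld, *Sharper bounds
for the Chebyshev functions θ(x) and ψ(x). II*, Math. Comp. 30 (1976), 337–360, Cor. 1,
eq. (6.18)). Under the Riemann hypothesis, `|π(x) − li(x)| < √x log x / (8π)` for all
`x ≥ 2657`. As printed (Schoenfeld's `li` is the principal-value logarithmic integral,
`= logIntegral`). Users take `(h : schoenfeld_explicit)`. [cite: Schoenfeld1976, Cor. 1 (6.18)] -/
def schoenfeld_explicit : Prop :=
  RiemannHypothesis →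
    ∀ x : ℝ, 2657 ≤ x →
      |(Nat.primeCounting ⌊x⌋₊ : ℝ) - logIntegral x| < Real.sqrt x * Real.log x / (8 * π)

/-! ## rh.S26 — Li's criterion -/

/-- **rh.S26** NAMED FACT (Li's criterion; X.-J. Li, *The positivity of a sequence of numbers and
the Riemann hypothesis*, J. Number Theory 65 (1997), 325–333, Thm. 1; Bombieri–Lagarias,
J. Number Theory 77 (1999), Cor. 1). The Riemann hypothesis holds if and only if the Keiper–Li
coefficients `λ_n = (1/(n−1)!) dⁿ/dsⁿ [s^{n−1} log ξ(s)]|_{s=1}` (`keiperLiCoeff`; Li's `ξ` is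
`2 ·` Riemann's, which does not change `λ_n`, see the docstring of `keiperLiCoeff`) satisfy
`λ_n ≥ 0` for every `n ≥ 1`. Users take `(h : li_criterion)`. [cite: Li1997, Thm. 1] -/
def li_criterion : Prop :=
  RiemannHypothesis ↔ ∀ n : ℕ, 1 ≤ n → 0 ≤ keiperLiCoeff n

/-! ## rh.S39 — Pólya's Jensen-polynomial criterion -/

/-- **rh.S39** NAMED FACT (Pólya's Jensen-polynomial criterion; G. Pólya, *Über die
algebraisch-funktionentheoretischen Untersuchungen von J. L. W. V. Jensen*, Kgl. Danske Vid.
Sel. Math.-Fys. Medd. 7 (1927); as stated in Griffin–Ono–Rolen–Zagier, PNAS 116 (2019), §1: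
"RH is equivalent to the hyperbolicity of the polynomials `J^{d,n}_γ(X)` for all nonnegative
integers `d` and `n`", `γ` the Taylor coefficients of `(−1 + 4z²) Λ(1/2 + z) = ∑ γ(n) z^{2n}/n!`).
The Riemann hypothesis holds if and only if `JensenPolyaCriterion`
(`∀ d n, (jensenPoly xiTaylorCoeff d n).Splits`). Users take `(h : polya_jensen)`. [cite: Polya1927, via GORZ2019 §1] -/
def polya_jensen : Prop :=
  RiemannHypothesis ↔ JensenPolyaCriterion

end Literature.NumberTheory.LFunctions

namespace Literature.NumberTheory.LFunctions

/-! ## rh.S29 — Weil's criterion -/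

/-- **rh.S29** NAMED FACT (Weil's criterion; A. Weil, *Sur les "formules explicites" de la théorie
des nombres premiers*, Comm. Sém. Math. Univ. Lund (1952); as printed in E. Bombieri, *Remarks on
Weil's quadratic functional in the theory of prime numbers I*, Rend. Mat. Acc. Lincei (9) 11
(2000), 183–233, Thm. 2: "the Riemann Hypothesis is equivalent to the statement that
`T[f * f̄*] ≥ 0` on `C₀^∞((0, ∞))`, with equality only if `f` is identically `0`"; abstract:
"positive semidefinite if and only if the Riemann Hypothesis is true"). In the additive
coordinates `x = e^t` of the prelude (`weilFunctional`, `weilQuadratic g = W(g ⋆ g̃)`,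
`IsWeilTest g` = smooth with compact support): the Riemann hypothesis holds if and only if
`Re W(g ⋆ g̃) ≥ 0` for every smooth compactly supported `g : ℝ → ℂ` (`W(g ⋆ g̃)` is real,
`weilQuadratic_im`). Yoshida's fixed-support form `RH ↔ ∀ a > 0, WeilPositivityOn a`
(Yoshida 1992; Bombieri 2000 §§3–4) is this fact composed with
`uniformWeilPositivity_iff_weilPositivity` (`Literature/…/WeilCriterion.lean`). Users take
`(h : weil_criterion)`. [cite: Bombieri2000, Thm. 2] -/
def weil_criterion : Prop :=
  RiemannHypothesis ↔ Summit.RiemannHypothesis.RiemannHypothesis.WeilPositivity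

/-! ## rh.S13 — RH implies the density hypothesis -/

/-- **rh.S13** NAMED FACT (RH implies the Density Hypothesis; H. Iwaniec, E. Kowalski, *Analytic
Number Theory*, AMS Colloq. Publ. 53 (2004), §10.5, remark following the statement of the density
conjecture; Titchmarsh §9.15). Under RH, `N(σ, T) = 0` for `σ > 1/2` (no zeros with
`Re ρ ≥ σ > 1/2`), and `N(1/2, T) ≤ N(T) ≪ T log T ≪_ε T^{1+ε} = T^{2(1−1/2)+ε}`
(Riemann–von Mangoldt, `riemann_von_mangoldt`), so `ZeroDensityEstimate 2 (1/2)` holds.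
Folklore-level; recorded as a fact so that routes can take
`(h : densityHypothesis_of_riemannHypothesis)`; an in-tree proof needs only
`riemann_von_mangoldt` and the definition of `zetaZeroCountRe`. [cite: IwaniecKowalski2004, §10.5] -/
def densityHypothesis_of_riemannHypothesis : Prop :=
  RiemannHypothesis → DensityHypothesis

/-! ## rh.S31 — Montgomery's theorem on the form factor -/

/-- **rh.S31** NAMED FACT (Montgomery's theorem, uniform clause; H. L. Montgomery, *The pair
correlation of zeros of the zeta function*, Proc. Symp. Pure Math. 24 (1973), 181–193, Theorem
(p. 185); refined to `0 ≤ α ≤ 1` by Goldston–Montgomery 1987). As printed: "(Assume RH.) For real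
`α`, `T ≥ 2`, `F(α)` is real and `F(α) = F(−α)`. If `T > T₀(ε)` then `F(α) ≥ −ε` for all `α`.
For fixed `0 ≤ α < 1`, `F(α) = (1 + o(1)) T^{−2α} log T + α + o(1)` as `T → ∞`; this holds
uniformly for `0 ≤ α ≤ 1 − ε`." Spelled out with explicit quantifiers (and `|α|`, using
evenness): for all `δ, ε > 0`, for all sufficiently large `T` and all `|α| ≤ 1 − δ`,
`|F(α, T) − (T^{−2|α|} log T + |α|)| ≤ ε T^{−2|α|} log T + ε`. `F = montgomeryFormFactor` has
Montgomery's normalisation `(2π/(T log T)) ∑ T^{iα(γ−γ')} w(γ−γ')`, `w(u) = 4/(4+u²)`.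
Users take `(h : montgomery_pair_correlation_restricted)`. [cite: Montgomery1973, Theorem] -/
def montgomery_pair_correlation_restricted : Prop :=
  RiemannHypothesis →
    ∀ {δ ε : ℝ}, 0 < δ → 0 < ε →
      ∀ᶠ T : ℝ in atTop, ∀ α : ℝ, |α| ≤ 1 - δ →
        |montgomeryFormFactor α T - (T ^ (-2 * |α|) * Real.log T + |α|)| ≤
          ε * (T ^ (-2 * |α|) * Real.log T) + ε

/-- **rh.S31** NAMED FACT (Montgomery's theorem, fixed-`α` clause; Montgomery 1973, Theorem:
"for fixed `0 ≤ α < 1`, `F(α) = (1 + o(1)) T^{−2α} log T + α + o(1)` as `T → ∞`"). For fixed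
`0 < |α| < 1` the term `T^{−2|α|} log T` is itself `o(1)`, so the clause reads `F(α, T) → |α|`
(`α = 0` excluded: there `F(0, T) ∼ log T`). Follows from
`montgomery_pair_correlation_restricted` with `δ = 1 − |α|` and `T^{−2|α|} log T → 0`.
Users take `(h : tendsto_montgomeryFormFactor)`. [cite: Montgomery1973, Theorem] -/
def tendsto_montgomeryFormFactor : Prop :=
  RiemannHypothesis →
    ∀ {α : ℝ}, α ≠ 0 → |α| < 1 → Tendsto (montgomeryFormFactor α) atTop (𝓝 |α|)

/-! ## rh.S32 — Rudnick–Sarnak -/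

/-- **rh.S32** NAMED FACT (Rudnick–Sarnak; Z. Rudnick, P. Sarnak, *Zeros of principal
`L`-functions and random matrix theory*, Duke Math. J. 81 (1996), 269–322, **Theorem 1.2** for
`m = 1` (`L = ζ`); quoted in Katz–Sarnak, Bull. AMS 36 (1999), §1). As printed, Theorem 1.1
(p. 272) is the smoothed statement — for `f` satisfying TF1–TF3 with `supp f̂ ⊆ {∑_j |ξ_j| < 2/m}`
and `h(r) = ∫ g(u) e^{iru} du`, `g ∈ C_c^∞(ℝ)`,
`R_n(T, f, h) ∼ (m/2π) T log T · ∫ h(r)ⁿ dr · ∫_{ℝⁿ} f(x) W_n(x) δ((x_1 + ⋯ + x_n)/n) dx` — and does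
not assume RH (`h`, `f` are entire and are evaluated at the possibly complex `γ_j`); Theorem 1.2
(p. 273) is its consequence under RH: "With the assumptions of Theorem 1.1 and also RH for
`L(s, π)`, `R_n(B_N, f) → ∫_{ℝⁿ} f(x) W_n(x) δ((x_1 + ⋯ + x_n)/n) dx` as `N → ∞`." Here `B_N` is
the set of the first `N` normalised ordinates `γ̃_j = (m/2π) γ_j log γ_j` (`0 ≤ γ_1 ≤ γ_2 ≤ ⋯`
with multiplicity), `R_n(B_N, f) = (n!/N) ∑_{S ⊆ B_N, |S| = n} f(S)` ((1.3)), and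
`W_n(x) = det (K(x_i − x_j))`, `K(x) = sin πx/(πx)` ((1.5)). The fact below is Theorem 1.2 for
`m = 1`, RH-conditional exactly as printed (an earlier version of this docstring attributed it
to Theorem 1.1; the Lean statement is unchanged). Encodings: `n = k + 1`,
`R_n(B_N, f) = levelCorrelationSum (k+1) f N / N` (ordered `n`-tuples of distinct indices,
`= n! ×` subsets for symmetric `f`), TF1–TF3 = `IsRSTestFunction k f` (TF3 as "Schwartz
slice"), support condition = `HasRSFourierSupport k f`, limit = `rsLimit k f`
(`= ∫ f W_n δ(x̄)` in slice coordinates). In the tree the fact is reduced to Rudnick–Sarnak's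
Theorem 3.2 for `ζ` (the named fact `rudnick_sarnak_unrestricted` of `RudnickSarnak.lean`) by
`rudnick_sarnak_of_unrestricted` (`RHConditionalFactsRudnickSarnakProofs.lean`), their §4
sieving and Theorem 4.1 being proved (`rudnick_sarnak_thm41_holds`).
Users take `(h : rudnick_sarnak)`. [cite: RudnickSarnak1996, Thm 1.2] -/
def rudnick_sarnak : Prop :=
  RiemannHypothesis →
    ∀ {k : ℕ}, 1 ≤ k → ∀ {f : (Fin (k + 1) → ℝ) → ℂ}, IsRSTestFunction k f →
      HasRSFourierSupport k f →
        Tendsto (fun N : ℕ ↦ levelCorrelationSum (k + 1) f N / N) atTop (𝓝 (rsLimit k f))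

end Literature.NumberTheory.LFunctions

end
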